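import Summits.Ventures.PercRepro.Night2ParallelReduction

/-!
# PercRepro — the parallel reduction at EVERY `(p, q)`, core (night-2, gen 11)

`Night2ParallelReduction.lean` proves the parallel reduction of the shadow form at the diagonal `(q + 2, q)`.
This file repeats it at an arbitrary pair `(p, q)`, for a matroid of rank `p` (any matroid truncates to rank `p`
without changing its shadow condition, `shadowHall_of_truncate`); `Night2ParallelGeneral.lean` draws the
consequence `shadowC025_of_simple` (`ShadowC025` reduces to simple matroids):

* `erase_mem_Uq_contract_gen`, `insert_mem_shadow_of_contract_gen`, `mem_Uq_delete_of_insert_mem_gen`,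
  `shadow_delete_subset_gen`, `mem_Uq_delete_of_notMem_clF_gen` — the `(p, q)` versions of the gen-5 / gen-11
  bookkeeping (contract `e'` for the members with `e' ∈ cl B`, delete `e'` for the collisions and for the
  members with `e' ∉ cl B`, the latter never bad when `e'` has a parallel partner);
* `one_le_of_mem_clF`: a non-loop in the closure of a rank-`q` set forces `q ≥ 1`, so the contraction side is
  empty at `q = 0` and the lower statement is only needed for `q ≥ 1`;
* **`shadow_card_of_parallel_gen`**: with constants `0 ≤ c ≤ c'`, `ShadowHall (M ／ {e'}) (p − 1) (q − 1) c'`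
  (for `q ≥ 1`) and `ShadowHall (M ＼ {e'}) p q c` give `c · #𝒜 ≤ #shadow M p q 𝒜` (`e' ∈ cl {e}`, `e ≠ e'`,
  `r(M) = p`);
* `eRank_contract_singleton`: contracting a non-loop lowers the rank by one.
-/

open scoped Matroid

namespace PercRepro.Shadow

open Finset PerFlat ThmH

variable {α : Type} [DecidableEq α] {M : Matroid α} [M.Finite]

section General

variable {p q : ℕ} {e e' : α}

/-- `0 ≤ Φ(p, q)`. -/
theorem phiK_nonneg_gen (p q : ℕ) : 0 ≤ phiK p q := by
  unfold phiK
  positivity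

/-- For a bottom set `B` at `(p, q)` with `e ∈ cl B` (`e` a non-loop, `q ≥ 1`, `r(M) = p`), `B ∖ {e}` is a
bottom set of `M ／ {e}` at `(p − 1, q − 1)`. -/
theorem erase_mem_Uq_contract_gen (he : M.Indep {e}) (hq : 1 ≤ q) (hM : M.eRank = (p : ℕ∞))
    {B : Finset α} (hB : B ∈ Uq M p q) (hcl : e ∈ clF M B) :
    B.erase e ∈ Uq (M ／ ({e} : Set α)) (p - 1) (q - 1) := by
  rw [mem_Uq] at hB ⊢
  obtain ⟨hBg, hBq, hBc⟩ := hB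
  have hecl : e ∈ M.closure (B : Set α) := by rw [← coe_clF]; exact_mod_cast hcl
  refine ⟨?_, ?_, ?_⟩
  · rw [gr_contract]
    exact Finset.erase_subset_erase e hBg
  · have hX : ((B.erase e : Finset α) : Set α) ⊆ M.E \ {e} := by
      rw [Finset.coe_erase]
      exact Set.sdiff_subset_sdiff_left (by rw [← coe_gr]; exact_mod_cast hBg)
    have h1 := contract_singleton_eRk_add_one he hX
    have h2 : insert e ((B.erase e : Finset α) : Set α) = insert e (B : Set α) := by
      rw [Finset.coe_erase, Set.insert_sdiff_singleton]
    rw [h2, eRk_insert_eq_of_mem_closure (by rw [← coe_gr]; exact_mod_cast hBg) hecl, hBq] at h1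
    obtain ⟨m, hm⟩ := exists_nat_eq_eRk (M ／ ({e} : Set α)) (B.erase e)
    rw [← hm] at h1 ⊢
    have h3 : m + 1 = q := by exact_mod_cast h1
    congr 1
    omega
  · rw [gr_contract, erase_sdiff_erase]
    have hX : (((gr M \ B).erase e : Finset α) : Set α) ⊆ M.E \ {e} := by
      rw [Finset.coe_erase]
      exact Set.sdiff_subset_sdiff_left (by rw [← coe_gr]; exact_mod_cast Finset.sdiff_subset)
    have h1 := contract_singleton_eRk_add_one he hX
    have h2 : insert e (((gr M \ B).erase e : Finset α) : Set α) = insert e ((gr M \ B : Finset α) : Set α) := by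
      rw [Finset.coe_erase, Set.insert_sdiff_singleton]
    have h3 : M.eRk (insert e ((gr M \ B : Finset α) : Set α)) = (p : ℕ∞) := by
      apply le_antisymm
      · rw [← hM]; exact M.eRk_le_eRank _
      · rw [← hBc]; exact M.eRk_mono (Set.subset_insert _ _)
    rw [h2, h3] at h1
    obtain ⟨m, hm⟩ := exists_nat_eq_eRk (M ／ ({e} : Set α)) ((gr M \ B).erase e)
    rw [← hm] at h1 ⊢
    have h4 : m + 1 = p := by exact_mod_cast h1
    congr 1
    omega

/-- A middle-level set `S′` of `M ／ {e}` at `(p − 1, q − 1)` above `B ∖ {e}` (`B ∈ 𝒜`) gives the middle-level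
set `S′ ∪ {e}` of `M` at `(p, q)` above `B`; such sets avoid `e`. -/
theorem insert_mem_shadow_of_contract_gen (he : M.Indep {e}) {𝒜 : Finset (Finset α)}
    {S : Finset α} (hS : S ∈ shadow (M ／ ({e} : Set α)) (p - 1) (q - 1) (𝒜.image (fun B => B.erase e))) :
    e ∉ S ∧ insert e S ∈ shadow M p q 𝒜 := by
  have heE : e ∈ M.E := he.subset_ground (Set.mem_singleton e)
  rw [mem_shadow] at hS
  obtain ⟨hY, B', hB', hB'S⟩ := hS
  unfold Yq at hY
  rw [Finset.mem_filter, Finset.mem_powerset, gr_contract] at hY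
  obtain ⟨hSg, hlo, hhi⟩ := hY
  have heS : e ∉ S := fun h => (Finset.mem_erase.1 (hSg h)).1 rfl
  have hSg' : S ⊆ gr M := hSg.trans (Finset.erase_subset _ _)
  refine ⟨heS, ?_⟩
  rw [mem_shadow]
  refine ⟨?_, ?_⟩
  · have hX : ((S : Finset α) : Set α) ⊆ M.E \ {e} := by
      rw [← coe_gr, ← Finset.coe_erase]
      exact_mod_cast hSg
    have h1 := contract_singleton_eRk_add_one he hX
    obtain ⟨m, hm⟩ := exists_nat_eq_eRk (M ／ ({e} : Set α)) S
    rw [← hm] at h1 hlo hhi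
    have hlo' : q - 1 < m := by exact_mod_cast hlo
    have hhi' : m < p - 1 := by exact_mod_cast hhi
    have hr : M.eRk ((insert e S : Finset α) : Set α) = ((m + 1 : ℕ) : ℕ∞) := by
      rw [Finset.coe_insert, ← h1]
      push_cast
      rfl
    unfold Yq
    rw [Finset.mem_filter, Finset.mem_powerset, hr]
    refine ⟨Finset.insert_subset (by rw [← Finset.mem_coe, coe_gr]; exact heE) hSg', ?_, ?_⟩
    · exact_mod_cast (by omega : q < m + 1)
    · exact_mod_cast (by omega : m + 1 < p)
  · rw [Finset.mem_image] at hB'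
    obtain ⟨B, hB, rfl⟩ := hB'
    refine ⟨B, hB, ?_⟩
    calc B ⊆ insert e (B.erase e) := Finset.insert_erase_subset e B
      _ ⊆ insert e S := Finset.insert_subset_insert e hB'S

/-- A collision member (`e ∉ B`, `B ∪ {e} ∈ Uq M p q`) is a bottom set of `M ＼ {e}` at `(p, q)`. -/
theorem mem_Uq_delete_of_insert_mem_gen {B : Finset α} (hB : B ∈ Uq M p q) (heB : e ∉ B)
    (hBe : insert e B ∈ Uq M p q) : B ∈ Uq (M ＼ ({e} : Set α)) p q := by
  rw [mem_Uq] at hB hBe ⊢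
  obtain ⟨hBg, hBq, -⟩ := hB
  obtain ⟨-, -, hBec⟩ := hBe
  have hX : ((B : Finset α) : Set α) ⊆ M.E \ {e} := by
    rw [← coe_gr, ← Finset.coe_erase]
    exact_mod_cast (Finset.subset_erase.2 ⟨hBg, heB⟩)
  refine ⟨?_, ?_, ?_⟩
  · rw [gr_delete]; exact Finset.subset_erase.2 ⟨hBg, heB⟩
  · rw [delete_singleton_eRk_eq hX, hBq]
  · rw [gr_delete]
    have h1 : (gr M).erase e \ B = gr M \ insert e B := by
      ext x
      simp only [Finset.mem_sdiff, Finset.mem_erase, Finset.mem_insert]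
      tauto
    rw [h1]
    have hX' : ((gr M \ insert e B : Finset α) : Set α) ⊆ M.E \ {e} := by
      rw [← coe_gr, ← Finset.coe_erase]
      have hsub : gr M \ insert e B ⊆ (gr M).erase e := by
        intro x hx
        rw [Finset.mem_sdiff, Finset.mem_insert] at hx
        rw [Finset.mem_erase]
        exact ⟨fun h => hx.2 (Or.inl h), hx.1⟩
      exact_mod_cast hsub
    rw [delete_singleton_eRk_eq hX', hBec]

/-- The middle-level sets of `M ＼ {e}` at `(p, q)` above a family `𝒞 ⊆ 𝒜` are middle-level sets of `M` above
`𝒜`, avoiding `e`. -/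
theorem shadow_delete_subset_gen {𝒜 𝒞 : Finset (Finset α)} (h𝒞 : 𝒞 ⊆ 𝒜) :
    ∀ S ∈ shadow (M ＼ ({e} : Set α)) p q 𝒞, e ∉ S ∧ S ∈ shadow M p q 𝒜 := by
  intro S hS
  rw [mem_shadow] at hS
  obtain ⟨hY, B, hB, hBS⟩ := hS
  unfold Yq at hY
  rw [Finset.mem_filter, Finset.mem_powerset, gr_delete] at hY
  obtain ⟨hSg, h1, h2⟩ := hY
  have heS : e ∉ S := fun h => (Finset.mem_erase.1 (hSg h)).1 rfl
  have hX : ((S : Finset α) : Set α) ⊆ M.E \ {e} := by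
    rw [← coe_gr, ← Finset.coe_erase]
    exact_mod_cast hSg
  rw [delete_singleton_eRk_eq hX] at h1 h2
  refine ⟨heS, ?_⟩
  rw [mem_shadow]
  refine ⟨?_, B, h𝒞 hB, hBS⟩
  unfold Yq
  rw [Finset.mem_filter, Finset.mem_powerset]
  exact ⟨hSg.trans (Finset.erase_subset _ _), h1, h2⟩

/-- **No bad member in the mixed regime of a parallel element, at every `(p, q)`**: a bottom set `B` whose
closure misses `e'`, where `e' ∈ cl {e}` for some `e ≠ e'` of the ground set, is a bottom set of `M ＼ {e'}`. -/
theorem mem_Uq_delete_of_notMem_clF_gen (he : e ∈ M.E) (hpar : e' ∈ M.closure {e}) (hne : e ≠ e')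
    {B : Finset α} (hB : B ∈ Uq M p q) (hcl : e' ∉ clF M B) :
    B ∈ Uq (M ＼ ({e'} : Set α)) p q := by
  have he'B : e' ∉ B := notMem_of_notMem_clF hB hcl
  have he'E : e' ∈ M.E := M.closure_subset_ground _ hpar
  rw [mem_Uq] at hB ⊢
  obtain ⟨hBg, hBq, hBc⟩ := hB
  have heB : e ∉ B := fun h => hcl (mem_clF_of_mem_closure_singleton hpar h)
  have heg : e ∈ gr M := by rw [← Finset.mem_coe, coe_gr]; exact he
  have he'g : e' ∈ gr M := by rw [← Finset.mem_coe, coe_gr]; exact he'E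
  have hX : ((B : Finset α) : Set α) ⊆ M.E \ {e'} := by
    rw [← coe_gr, ← Finset.coe_erase]
    exact_mod_cast (Finset.subset_erase.2 ⟨hBg, he'B⟩)
  refine ⟨?_, ?_, ?_⟩
  · rw [gr_delete]; exact Finset.subset_erase.2 ⟨hBg, he'B⟩
  · rw [delete_singleton_eRk_eq hX, hBq]
  · rw [gr_delete]
    have h1 : (gr M).erase e' \ B = (gr M \ B).erase e' := by
      ext x
      simp only [Finset.mem_sdiff, Finset.mem_erase]
      tauto
    rw [h1]
    have hX' : (((gr M \ B).erase e' : Finset α) : Set α) ⊆ M.E \ {e'} := by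
      rw [← coe_gr, ← Finset.coe_erase]
      exact_mod_cast (Finset.erase_subset_erase e' (Finset.sdiff_subset (s := gr M) (t := B)))
    rw [delete_singleton_eRk_eq hX']
    have hemem : e ∈ (gr M \ B).erase e' := Finset.mem_erase.2 ⟨hne, Finset.mem_sdiff.2 ⟨heg, heB⟩⟩
    have hcl' : e' ∈ M.closure (((gr M \ B).erase e' : Finset α) : Set α) :=
      M.closure_subset_closure (Set.singleton_subset_iff.2 (Finset.mem_coe.2 hemem)) hpar
    have hsub : (((gr M \ B).erase e' : Finset α) : Set α) ⊆ M.E := hX'.trans Set.sdiff_subset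
    have h2 : insert e' (((gr M \ B).erase e' : Finset α) : Set α) = ((gr M \ B : Finset α) : Set α) := by
      rw [Finset.coe_erase, Set.insert_sdiff_singleton, Set.insert_eq_of_mem]
      exact Finset.mem_coe.2 (Finset.mem_sdiff.2 ⟨he'g, he'B⟩)
    rw [← eRk_insert_eq_of_mem_closure hsub hcl', h2]
    exact hBc

omit [DecidableEq α] in
/-- A non-loop `e'` in the closure of a set `B ⊆ E` of rank `q` forces `q ≥ 1`. -/
theorem one_le_of_mem_clF (he' : M.Indep {e'}) {B : Finset α} (hB : B ⊆ gr M)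
    (hBq : M.eRk (B : Set α) = (q : ℕ∞)) (hcl : e' ∈ clF M B) : 1 ≤ q := by
  by_contra hq
  have hq0 : q = 0 := by omega
  subst hq0
  have hBE : (B : Set α) ⊆ M.E := by rw [← coe_gr]; exact_mod_cast hB
  have hcl' : e' ∈ M.closure (B : Set α) := by rw [← coe_clF]; exact_mod_cast hcl
  have h1 : M.eRk (insert e' (B : Set α)) = 0 := by
    rw [eRk_insert_eq_of_mem_closure hBE hcl', hBq]
    rfl
  have h2 : M.eRk ({e'} : Set α) ≤ M.eRk (insert e' (B : Set α)) :=
    M.eRk_mono (Set.singleton_subset_iff.2 (Set.mem_insert _ _))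
  rw [he'.eRk_eq_encard, Set.encard_singleton, h1] at h2
  exact absurd h2 (by simp)

/-- **The arithmetic of the general parallel reduction**: `0 ≤ c ≤ c'`, `0 ≤ a`, `A ≤ a + d`, `c'·a ≤ s₁`,
`c·d ≤ s₀` give `c·A ≤ s₁ + s₀`. -/
theorem parallel_arith_gen {c c' A a d s₁ s₀ : ℚ} (hc : 0 ≤ c) (hcc' : c ≤ c') (ha : 0 ≤ a)
    (hA : A ≤ a + d) (h₁ : c' * a ≤ s₁) (h₀ : c * d ≤ s₀) : c * A ≤ s₁ + s₀ := by
  nlinarith [mul_le_mul_of_nonneg_left hA hc, mul_le_mul_of_nonneg_right hcc' ha]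

/-- **The parallel reduction at `(p, q)`.**  Let `e'` be a non-loop with a parallel partner `e ∈ E`
(`e' ∈ cl {e}`, `e ≠ e'`), `r(M) = p`, and `0 ≤ c ≤ c'`.  If `ShadowHall (M ／ {e'}) (p − 1) (q − 1) c'` (needed
only when `q ≥ 1`) and `ShadowHall (M ＼ {e'}) p q c`, then `c · #𝒜 ≤ #shadow M p q 𝒜` for every
`𝒜 ⊆ Uq M p q`. -/
theorem shadow_card_of_parallel_gen (he'i : M.Indep {e'}) (he : e ∈ M.E) (hpar : e' ∈ M.closure {e})
    (hne : e ≠ e') (hM : M.eRank = (p : ℕ∞)) {c c' : ℚ} (hc : 0 ≤ c) (hcc' : c ≤ c')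
    {𝒜 : Finset (Finset α)} (h𝒜 : 𝒜 ⊆ Uq M p q)
    (IHc : 1 ≤ q → ShadowHall (M ／ ({e'} : Set α)) (p - 1) (q - 1) c')
    (IHd : ShadowHall (M ＼ ({e'} : Set α)) p q c) :
    c * (𝒜.card : ℚ) ≤ ((shadow M p q 𝒜).card : ℚ) := by
  -- the two halves of `𝒜`: `e' ∈ cl B` (contracted) and `e' ∉ cl B` (deleted)
  set 𝒜c : Finset (Finset α) := 𝒜.filter (fun B => e' ∈ clF M B) with h𝒜c
  set 𝒜d : Finset (Finset α) := 𝒜.filter (fun B => e' ∉ clF M B) with h𝒜d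
  have h𝒜cA : 𝒜c ⊆ 𝒜 := Finset.filter_subset _ _
  have h𝒜dA : 𝒜d ⊆ 𝒜 := Finset.filter_subset _ _
  have hsplit : 𝒜.card = 𝒜c.card + 𝒜d.card := by
    rw [h𝒜c, h𝒜d, Finset.card_filter_add_card_filter_not]
  -- the contracted family and the collision family
  set 𝒜' : Finset (Finset α) := 𝒜c.image (fun B => B.erase e') with h𝒜'
  set 𝒞 : Finset (Finset α) := 𝒜c.filter (fun B => e' ∉ B ∧ insert e' B ∈ 𝒜c) with h𝒞
  have h𝒞sub : 𝒞 ⊆ 𝒜c := Finset.filter_subset _ _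
  have hcount : 𝒜c.card ≤ 𝒜'.card + 𝒞.card := by
    have := card_le_card_image_erase_add 𝒜c e'
    rwa [← h𝒜', ← h𝒞] at this
  -- every member of 𝒜c forces q ≥ 1
  have hq_of : ∀ B ∈ 𝒜c, 1 ≤ q := by
    intro B hB
    rw [h𝒜c, Finset.mem_filter] at hB
    have hBU := mem_Uq.1 (h𝒜 hB.1)
    exact one_le_of_mem_clF he'i hBU.1 hBU.2.1 hB.2
  -- 𝒜' ⊆ Uq (M ／ {e'}) (p-1) (q-1)
  have h𝒜'U : 𝒜' ⊆ Uq (M ／ ({e'} : Set α)) (p - 1) (q - 1) := by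
    intro B' hB'
    rw [h𝒜', Finset.mem_image] at hB'
    obtain ⟨B, hB, rfl⟩ := hB'
    have hq := hq_of B hB
    rw [h𝒜c, Finset.mem_filter] at hB
    exact erase_mem_Uq_contract_gen he'i hq hM (h𝒜 hB.1) hB.2
  -- the deletion-side family 𝒟 = 𝒞 ∪ 𝒜d ⊆ Uq (M ＼ {e'}) p q
  set 𝒟 : Finset (Finset α) := 𝒞 ∪ 𝒜d with h𝒟
  have h𝒟U : 𝒟 ⊆ Uq (M ＼ ({e'} : Set α)) p q := by
    intro B hB
    rw [h𝒟, Finset.mem_union] at hB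
    rcases hB with hB | hB
    · rw [h𝒞, Finset.mem_filter] at hB
      exact mem_Uq_delete_of_insert_mem_gen (h𝒜 (h𝒜cA hB.1)) hB.2.1 (h𝒜 (h𝒜cA hB.2.2))
    · rw [h𝒜d, Finset.mem_filter] at hB
      exact mem_Uq_delete_of_notMem_clF_gen he hpar hne (h𝒜 hB.1) hB.2
  have h𝒟A : 𝒟 ⊆ 𝒜 := Finset.union_subset (h𝒞sub.trans h𝒜cA) h𝒜dA
  have h𝒟card : 𝒟.card = 𝒞.card + 𝒜d.card := by
    rw [h𝒟, Finset.card_union_of_disjoint]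
    rw [Finset.disjoint_left]
    intro B hB hBd
    rw [h𝒞, Finset.mem_filter, h𝒜c, Finset.mem_filter] at hB
    rw [h𝒜d, Finset.mem_filter] at hBd
    exact hBd.2 hB.1.2
  -- the two IH shadows inside the shadow of 𝒜, in the halves e' ∈ S / e' ∉ S
  set S1 : Finset (Finset α) :=
    (shadow (M ／ ({e'} : Set α)) (p - 1) (q - 1) 𝒜').image (fun S => insert e' S) with hS1
  have hS1card : S1.card = (shadow (M ／ ({e'} : Set α)) (p - 1) (q - 1) 𝒜').card := by
    apply Finset.card_image_of_injOn
    intro S hS S' hS' hSS'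
    have h1 : e' ∉ S :=
      (insert_mem_shadow_of_contract_gen (p := p) (q := q) he'i (𝒜 := 𝒜c) (by rwa [← h𝒜'])).1
    have h2 : e' ∉ S' :=
      (insert_mem_shadow_of_contract_gen (p := p) (q := q) he'i (𝒜 := 𝒜c) (by rwa [← h𝒜'])).1
    have hSS'' : insert e' S = insert e' S' := hSS'
    calc S = (insert e' S).erase e' := (Finset.erase_insert h1).symm
      _ = (insert e' S').erase e' := by rw [hSS'']
      _ = S' := Finset.erase_insert h2
  have hS1sub : S1 ⊆ shadow M p q 𝒜 := by
    intro S hS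
    rw [hS1, Finset.mem_image] at hS
    obtain ⟨S', hS', rfl⟩ := hS
    exact shadow_mono h𝒜cA (insert_mem_shadow_of_contract_gen he'i (𝒜 := 𝒜c) (by rwa [← h𝒜'])).2
  have hS1e : ∀ S ∈ S1, e' ∈ S := by
    intro S hS
    rw [hS1, Finset.mem_image] at hS
    obtain ⟨S', -, rfl⟩ := hS
    exact Finset.mem_insert_self _ _
  set S0 : Finset (Finset α) := shadow (M ＼ ({e'} : Set α)) p q 𝒟 with hS0
  have hS0sub : S0 ⊆ shadow M p q 𝒜 := fun S hS => (shadow_delete_subset_gen h𝒟A S hS).2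
  have hS0e : ∀ S ∈ S0, e' ∉ S := fun S hS => (shadow_delete_subset_gen h𝒟A S hS).1
  have hdisj : Disjoint S1 S0 := by
    rw [Finset.disjoint_left]
    intro S h1 h0
    exact hS0e S h0 (hS1e S h1)
  have hunion : (S1 ∪ S0).card ≤ (shadow M p q 𝒜).card :=
    Finset.card_le_card (Finset.union_subset hS1sub hS0sub)
  rw [Finset.card_union_of_disjoint hdisj, hS1card] at hunion
  -- the contraction-side inequality: void when 𝒜c is empty, else from IHc (then q ≥ 1)
  have hIH1 : c' * (𝒜'.card : ℚ) ≤ ((shadow (M ／ ({e'} : Set α)) (p - 1) (q - 1) 𝒜').card : ℚ) := by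
    by_cases hemp : 𝒜c = ∅
    · have h𝒜'e : 𝒜' = ∅ := by rw [h𝒜', hemp, Finset.image_empty]
      rw [h𝒜'e, Finset.card_empty, Nat.cast_zero, mul_zero]
      exact Nat.cast_nonneg _
    · obtain ⟨B, hB⟩ := Finset.nonempty_iff_ne_empty.2 hemp
      exact IHc (hq_of B hB) 𝒜' h𝒜'U
  have hIH0 := IHd 𝒟 h𝒟U
  have hA : (𝒜.card : ℚ) ≤ (𝒜'.card : ℚ) + (𝒟.card : ℚ) := by
    have h : 𝒜.card ≤ 𝒜'.card + 𝒟.card := by omega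
    rw [← Nat.cast_add]
    exact Nat.cast_le.2 h
  have hunion' : ((shadow (M ／ ({e'} : Set α)) (p - 1) (q - 1) 𝒜').card : ℚ) + (S0.card : ℚ)
      ≤ ((shadow M p q 𝒜).card : ℚ) := by
    rw [← Nat.cast_add]
    exact Nat.cast_le.2 hunion
  exact (parallel_arith_gen hc hcc' (Nat.cast_nonneg _) hA hIH1 hIH0).trans hunion'

omit [DecidableEq α] [M.Finite] in
/-- Contracting a non-loop lowers the rank by one: `r(M ／ {e}) = p − 1` when `r(M) = p`. -/
theorem eRank_contract_singleton (he : M.Indep {e}) {p : ℕ} (hM : M.eRank = (p : ℕ∞)) :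
    (M ／ ({e} : Set α)).eRank = ((p - 1 : ℕ) : ℕ∞) := by
  have heE : e ∈ M.E := he.subset_ground (Set.mem_singleton e)
  have h1 := contract_singleton_eRk_add_one he (X := M.E \ {e}) (subset_refl _)
  rw [Set.insert_sdiff_singleton, Set.insert_eq_of_mem heE, Matroid.eRk_ground, hM] at h1
  obtain ⟨m, hm⟩ : ∃ m : ℕ, (m : ℕ∞) = (M ／ ({e} : Set α)).eRk (M.E \ {e}) := by
    apply ENat.ne_top_iff_exists.1
    intro htop
    rw [htop] at h1
    exact absurd h1 (by simp)
  rw [Matroid.eRank_def, Matroid.contract_ground, ← hm]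
  rw [← hm] at h1
  have h2 : m + 1 = p := by exact_mod_cast h1
  congr 1
  omega

end General

end PercRepro.Shadow
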